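import Literature.NumberTheory.LFunctions.ZetaZeroDensitySelbergExplicit
import Literature.NumberTheory.LFunctions.ZetaZeroDensityExplicit
import Mathlib.Analysis.SpecialFunctions.Pow.Real
import Mathlib.Algebra.Order.Archimedean.Basic
import HarnessLib

/-!
# RH-FREE consequence, PROVED — Simonič's dyadic zero-density corollary derived from his Theorem 1 and the numerical verification of RH («nothing here bears on the truth of RH»)

Topic `Literature/NumberTheory/LFunctions` (RH literature-typing tranche 1, L4 "explicit zero
statistics"; proofs companion of `ZetaZeroDensitySelbergExplicit.lean`). Label: **RH-FREE** —
an implication between unconditional named facts already in the tree; no new named fact (D-0026).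
Nothing here bears on the truth of RH.

Source: A. Simonič, *Explicit zero density estimate for the Riemann zeta-function near the critical
line*, J. Math. Anal. Appl. **491** (2020) 124303 = arXiv:1910.08274v2, §1, the display after
Theorem 1: "Under the assumptions of Theorem 1, an immediate corollary is
`N(σ,T) ≤ 10395.21/(2^{1−¼(σ−½)} − 1) · T^{1−¼(σ−½)} log(T/2)` for `T ≥ 2H₀`."

## What is proved

`Simonic2020_thm1.dyadic` :
  `Simonic2020_thm1 → platt_trudgian_numerical_rh → Simonic2020_thm1_dyadic`,
the dyadic summation behind "immediate": with `e = 1 − ¼(σ−½) ∈ [0.917, 1]` and `K ≥ 1` chosen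
with `H₀ ≤ T/2^K < 2H₀`,
`N(σ', T) = N(σ', T/2^K) + Σ_{j=1}^{K} [N(σ', T/2^{j−1}) − N(σ', T/2^j)]`, where `N(σ', T/2^K) = 0`
for `σ' > ½` by the numerical verification of RH up to `3·10¹²` (> `2H₀`; the tree's fact
`platt_trudgian_numerical_rh`, through `zetaZeroCountRe_eq_zero_of_numerical_rh` — the source uses
Platt's `H₀` itself plus one more application of Theorem 1), each bracket is `≤ a x^e log x + b log²x
+ c log x log log x + d log x` at `x = T/2^j ≥ H₀` (Theorem 1), the main terms sum to
`≤ a T^e log(T/2) Σ_{j≥1} 2^{−je} = a T^e log(T/2)/(2^e − 1)`, and the `K ≤ log T/log 2` lower-order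
terms are absorbed by the increment `10395.2 → 10395.21` (`K · 1.3 log²T ≤ 0.01 T^e log(T/2)` for
`T ≥ 2H₀`, via `log T ≤ 4T^{1/4}` and `T^{1/3} ≥ 3136`).

Conventions: as in `ZetaZeroDensitySelbergExplicit.lean` (`N(σ,·)` open in `σ` is rendered as the
tree's closed `zetaZeroCountRe σ' ·` for every `σ' > σ`).

## References

* A. Simonič, J. Math. Anal. Appl. 491 (2020) 124303, Thm. 1 and the display after it
  (arXiv:1910.08274v2). [Simonic2020]
* D. Platt, T. Trudgian, Bull. Lond. Math. Soc. 53 (2021) 792–797, Thm. 1 (the tree's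
  `platt_trudgian_numerical_rh`). [PlattTrudgianBLMS2021]
-/

noncomputable section

open Real Finset

namespace Literature.NumberTheory.LFunctions

namespace Simonic2020Dyadic

/-- **Dyadic iteration of Theorem 1**: if `H₀ ≤ T/2^K` then
`N(σ',T) ≤ N(σ',T/2^K) + Σ_{j<K} f(T/2^{j+1})`. [cite: Simonic2020, Thm. 1 (dyadic summation)] -/
private theorem iterate (h : Simonic2020_thm1) {σ σ' : ℝ} (hσ : 1 / 2 ≤ σ) (hσ1 : σ ≤ 0.831)
    (hσσ' : σ < σ') :
    ∀ (K : ℕ) (T : ℝ), Simonic2020.H₀ ≤ T / 2 ^ K →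
      (zetaZeroCountRe σ' T : ℝ) ≤ zetaZeroCountRe σ' (T / 2 ^ K)
        + ∑ j ∈ range K, (10395.2 * (T / 2 ^ (j + 1)) ^ (Simonic2020.selbergExponent σ) * Real.log (T / 2 ^ (j + 1)) + 1.104 * Real.log (T / 2 ^ (j + 1)) ^ 2
        + 0.173 * Real.log (T / 2 ^ (j + 1)) * Real.log (Real.log (T / 2 ^ (j + 1))) + 0.51 * Real.log (T / 2 ^ (j + 1)))
  | 0, T, _ => by simp
  | K + 1, T, hK => by
    -- apply the induction hypothesis to `T/2` with `K`
    have hK' : Simonic2020.H₀ ≤ (T / 2) / 2 ^ K := by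
      rw [div_div, ← pow_succ']; exact hK
    have ih := iterate h hσ hσ1 hσσ' K (T / 2) hK'
    -- Theorem 1 at the base point `T/2 ≥ H₀`
    have hbase : Simonic2020.H₀ ≤ T / 2 := by
      refine hK'.trans ?_
      have h2K : (1 : ℝ) ≤ 2 ^ K := one_le_pow₀ (by norm_num)
      have hT2 : 0 ≤ T / 2 := by
        have hH : (0 : ℝ) < Simonic2020.H₀ := by norm_num [Simonic2020.H₀]
        have : 0 ≤ (T / 2) / 2 ^ K := hH.le.trans hK'
        have h2 : (0 : ℝ) < 2 ^ K := by positivity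
        have := mul_nonneg this h2.le
        rwa [div_mul_cancel₀ _ h2.ne'] at this
      exact div_le_self hT2 h2K
    have h1 := h σ σ' (T / 2) hσ hσ1 hσσ' hbase
    have e2 : 2 * (T / 2) = T := by ring
    rw [e2] at h1
    rw [Finset.sum_range_succ', pow_one]
    have e3 : ∀ j ∈ range K, (10395.2 * (T / 2 / 2 ^ (j + 1)) ^ (Simonic2020.selbergExponent σ) * Real.log (T / 2 / 2 ^ (j + 1)) + 1.104 * Real.log (T / 2 / 2 ^ (j + 1)) ^ 2
        + 0.173 * Real.log (T / 2 / 2 ^ (j + 1)) * Real.log (Real.log (T / 2 / 2 ^ (j + 1))) + 0.51 * Real.log (T / 2 / 2 ^ (j + 1))) =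
        (10395.2 * (T / 2 ^ (j + 1 + 1)) ^ (Simonic2020.selbergExponent σ) * Real.log (T / 2 ^ (j + 1 + 1)) + 1.104 * Real.log (T / 2 ^ (j + 1 + 1)) ^ 2
        + 0.173 * Real.log (T / 2 ^ (j + 1 + 1)) * Real.log (Real.log (T / 2 ^ (j + 1 + 1))) + 0.51 * Real.log (T / 2 ^ (j + 1 + 1))) := by
      intro j _
      rw [div_div, ← pow_succ']
    rw [Finset.sum_congr rfl e3] at ih
    have e4 : T / 2 / 2 ^ K = T / 2 ^ (K + 1) := by rw [div_div, ← pow_succ']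
    rw [e4] at ih
    have hf : (zetaZeroCountRe σ' T : ℝ) - zetaZeroCountRe σ' (T / 2) ≤
        (10395.2 * (T / 2) ^ (Simonic2020.selbergExponent σ) * Real.log (T / 2) + 1.104 * Real.log (T / 2) ^ 2
        + 0.173 * Real.log (T / 2) * Real.log (Real.log (T / 2)) + 0.51 * Real.log (T / 2)) := by
      exact h1
    linarith

/-- Geometric bound: for `0 < r < 1`, `Σ_{j<K} r^{j+1} ≤ r/(1 − r)`. [folklore] -/
private theorem geom_bound {r : ℝ} (hr0 : 0 < r) (hr1 : r < 1) (K : ℕ) :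
    ∑ j ∈ range K, r ^ (j + 1) ≤ r / (1 - r) := by
  have h1 : ∑ j ∈ range K, r ^ (j + 1) = r * ∑ j ∈ range K, r ^ j := by
    rw [Finset.mul_sum]
    refine Finset.sum_congr rfl fun j _ ↦ ?_
    rw [pow_succ']
  rw [h1, geom_sum_eq hr1.ne K]
  have h2 : (r ^ K - 1) / (r - 1) = (1 - r ^ K) / (1 - r) := by
    rw [div_eq_div_iff (by linarith) (by linarith)]; ring
  rw [h2, mul_div_assoc']
  apply div_le_div_of_nonneg_right _ (by linarith)
  have : 0 ≤ r ^ K := by positivity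
  nlinarith

/-- `log x ≤ 4 x^{1/4}` for `x ≥ 0`. [folklore] -/
private theorem log_le_four_rpow {x : ℝ} (hx : 0 ≤ x) : Real.log x ≤ 4 * x ^ (1 / 4 : ℝ) := by
  have h := Real.log_le_rpow_div hx (by norm_num : (0 : ℝ) < 1 / 4)
  linarith [show x ^ (1 / 4 : ℝ) / (1 / 4) = 4 * x ^ (1 / 4 : ℝ) by ring]

/-- For `T ≥ 2H₀`: `3136 ≤ T^{1/3}` (`3136³ < 6·10¹⁰`). [folklore] -/
private theorem rpow_third_ge {T : ℝ} (hT : 2 * Simonic2020.H₀ ≤ T) : (3136 : ℝ) ≤ T ^ (1 / 3 : ℝ) := by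
  have hT0 : 0 ≤ T := le_trans (by norm_num [Simonic2020.H₀]) hT
  have h1 : ((3136 : ℝ) ^ 3) ^ ((3 : ℕ)⁻¹ : ℝ) ≤ T ^ ((3 : ℕ)⁻¹ : ℝ) := by
    refine Real.rpow_le_rpow (by positivity) ?_ (by positivity)
    exact le_trans (by norm_num [Simonic2020.H₀]) hT
  rw [Real.pow_rpow_inv_natCast (by norm_num) (by norm_num)] at h1
  have e : ((3 : ℕ)⁻¹ : ℝ) = 1 / 3 := by norm_num
  rwa [e] at h1

/-- The lower-order terms are absorbed: for `T ≥ 2H₀` and `0.917 ≤ e ≤ 1`,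
`(log T/log 2) · (1.104 log²T + 0.173 log T log log T + 0.51 log T) ≤ 0.01 T^e log(T/2)`.
[folklore] -/
private theorem lower_order_le {T e : ℝ} (hT : 2 * Simonic2020.H₀ ≤ T) (he : 0.917 ≤ e) :
    Real.log T / Real.log 2 *
        (1.104 * Real.log T ^ 2 + 0.173 * Real.log T * Real.log (Real.log T) + 0.51 * Real.log T) ≤
      0.01 * T ^ e * Real.log (T / 2) := by
  have hH : Simonic2020.H₀ = 30610046000 := rfl
  rw [hH] at hT
  have hT1 : (1 : ℝ) ≤ T := by linarith
  have hT0 : 0 < T := by linarith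
  -- log T ≥ 24
  have hL : (24 : ℝ) ≤ Real.log T := by
    rw [← Real.log_exp 24]
    refine Real.log_le_log (Real.exp_pos _) ?_
    have h := Real.exp_bound' (x := (1 : ℝ)) (by norm_num) (by norm_num) (n := 4) (by norm_num)
    simp only [Finset.sum_range_succ, Finset.sum_range_zero, Nat.factorial] at h
    norm_num at h
    have e24 : Real.exp 24 = Real.exp 1 ^ 24 := by rw [← Real.exp_nat_mul]; norm_num
    rw [e24]
    calc Real.exp 1 ^ 24 ≤ (2.72 : ℝ) ^ 24 :=
          pow_le_pow_left₀ (Real.exp_pos 1).le (by linarith [Real.exp_one_lt_d9]) 24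
      _ ≤ T := by norm_num; linarith
  have hL0 : 0 < Real.log T := by linarith
  have hlog2 := Real.log_two_gt_d9
  have hlog2' := Real.log_two_lt_d9
  -- log log T ≤ log T, and the bracket ≤ 1.3 log²T
  have hLL : Real.log (Real.log T) ≤ Real.log T := by
    have := Real.log_le_sub_one_of_pos hL0; linarith
  have hbr : 1.104 * Real.log T ^ 2 + 0.173 * Real.log T * Real.log (Real.log T) + 0.51 * Real.log T
      ≤ 1.3 * Real.log T ^ 2 := by nlinarith
  have hK : Real.log T / Real.log 2 ≤ 1.45 * Real.log T := by
    rw [div_le_iff₀ (by linarith)]; nlinarith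
  have hlhs : Real.log T / Real.log 2 *
      (1.104 * Real.log T ^ 2 + 0.173 * Real.log T * Real.log (Real.log T) + 0.51 * Real.log T) ≤
      1.885 * Real.log T ^ 3 := by
    have h0 : 0 ≤ Real.log T / Real.log 2 := by positivity
    calc Real.log T / Real.log 2 *
        (1.104 * Real.log T ^ 2 + 0.173 * Real.log T * Real.log (Real.log T) + 0.51 * Real.log T)
        ≤ Real.log T / Real.log 2 * (1.3 * Real.log T ^ 2) := mul_le_mul_of_nonneg_left hbr h0
      _ ≤ 1.45 * Real.log T * (1.3 * Real.log T ^ 2) :=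
          mul_le_mul_of_nonneg_right hK (by positivity)
      _ = 1.885 * Real.log T ^ 3 := by ring
  -- log(T/2) ≥ 0.97 log T
  have hlogT2 : 0.97 * Real.log T ≤ Real.log (T / 2) := by
    rw [Real.log_div hT0.ne' (by norm_num)]; linarith
  -- T^e ≥ T^{0.917} = T^{1/2} · T^{1/4} · T^{0.167} ≥ T^{1/2} T^{1/4} T^{1/6}·… we use T^{0.917} ≥ T^{11/12}
  have hTe : T ^ (11 / 12 : ℝ) ≤ T ^ e :=
    Real.rpow_le_rpow_of_exponent_le hT1 (by linarith)
  -- log T ≤ 4 T^{1/4}, so log² T ≤ 16 T^{1/2}; and T^{1/3} ≥ 3136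
  have hl4 := log_le_four_rpow hT0.le
  have h3 := rpow_third_ge (T := T) (by rw [hH]; exact hT)
  have hsplit : T ^ (11 / 12 : ℝ) = T ^ (1 / 4 : ℝ) * T ^ (1 / 4 : ℝ) * T ^ (1 / 3 : ℝ) *
      T ^ (1 / 12 : ℝ) := by
    rw [← Real.rpow_add hT0, ← Real.rpow_add hT0, ← Real.rpow_add hT0]; norm_num
  have h12 : (1 : ℝ) ≤ T ^ (1 / 12 : ℝ) := Real.one_le_rpow hT1 (by norm_num)
  have hq0 : 0 ≤ T ^ (1 / 4 : ℝ) := by positivity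
  -- log³T ≤ 64 (T^{1/4})³ ≤ 64 T^{1/4}·T^{1/4}·T^{1/4}; and T^{1/4} ≤ T^{1/3}/… we bound directly:
  -- 1.885 log³T ≤ 1.885·16 T^{1/2} log T and 0.01 T^e log(T/2) ≥ 0.0097 T^{11/12} log T
  have hlog2T : Real.log T ^ 2 ≤ 16 * (T ^ (1 / 4 : ℝ) * T ^ (1 / 4 : ℝ)) := by nlinarith
  have hmain : 1.885 * Real.log T ^ 3 ≤ 0.0097 * T ^ (11 / 12 : ℝ) * Real.log T := by
    rw [hsplit]
    have h31 : 1.885 * 16 ≤ 0.0097 * (T ^ (1 / 3 : ℝ) * T ^ (1 / 12 : ℝ)) := by nlinarith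
    have e1 : 1.885 * Real.log T ^ 3 = (1.885 * Real.log T ^ 2) * Real.log T := by ring
    have e2 : 0.0097 * (T ^ (1 / 4 : ℝ) * T ^ (1 / 4 : ℝ) * T ^ (1 / 3 : ℝ) * T ^ (1 / 12 : ℝ)) *
        Real.log T = (0.0097 * (T ^ (1 / 3 : ℝ) * T ^ (1 / 12 : ℝ))) *
          (T ^ (1 / 4 : ℝ) * T ^ (1 / 4 : ℝ)) * Real.log T := by ring
    rw [e1, e2]
    refine mul_le_mul_of_nonneg_right ?_ hL0.le
    nlinarith [mul_nonneg hq0 hq0]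
  have hrhs : 0.0097 * T ^ (11 / 12 : ℝ) * Real.log T ≤ 0.01 * T ^ e * Real.log (T / 2) := by
    have h1 : 0.0097 * T ^ (11 / 12 : ℝ) * Real.log T ≤ 0.0097 * T ^ e * Real.log T := by
      have := mul_le_mul_of_nonneg_right hTe hL0.le
      nlinarith
    have h2 : 0.0097 * T ^ e * Real.log T = 0.01 * T ^ e * (0.97 * Real.log T) := by ring
    rw [h2] at h1
    have hTe0 : 0 ≤ T ^ e := by positivity
    have h3 : 0.01 * T ^ e * (0.97 * Real.log T) ≤ 0.01 * T ^ e * Real.log (T / 2) :=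
      mul_le_mul_of_nonneg_left hlogT2 (by positivity)
    linarith
  linarith

/-- `(2^n)^e = (2^e)^n` for natural `n` and real `e`. [folklore] -/
private theorem two_pow_rpow (e : ℝ) (n : ℕ) : ((2 : ℝ) ^ n) ^ e = ((2 : ℝ) ^ e) ^ n := by
  calc ((2 : ℝ) ^ n) ^ e = ((2 : ℝ) ^ (n : ℝ)) ^ e := by rw [Real.rpow_natCast]
    _ = (2 : ℝ) ^ ((n : ℝ) * e) := by rw [Real.rpow_mul (by norm_num)]
    _ = (2 : ℝ) ^ (e * (n : ℝ)) := by rw [mul_comm]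
    _ = ((2 : ℝ) ^ e) ^ (n : ℝ) := by rw [Real.rpow_mul (by norm_num)]
    _ = ((2 : ℝ) ^ e) ^ n := by rw [Real.rpow_natCast]

/-- One dyadic summand: for `H₀ ≤ x ≤ T/2` (so `e < x ≤ T`), with `x^e = T^e · q`,
`f(x) ≤ a T^e log(T/2) · q + (b log²T + c log T log log T + d log T)`.
[cite: Simonic2020, Thm. 1 (dyadic summation)] -/
private theorem summand_le {T e q x : ℝ} (hT0 : 0 < T) (hL0 : 0 < Real.log T)
    (hx0 : 0 < x) (hxe : Real.exp 1 < x) (hxhi : x ≤ T / 2) (hq : 0 ≤ q) (hpow : x ^ e = T ^ e * q) :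
    (10395.2 * x ^ e * Real.log x + 1.104 * Real.log x ^ 2
        + 0.173 * Real.log x * Real.log (Real.log x) + 0.51 * Real.log x) ≤ 10395.2 * T ^ e * Real.log (T / 2) * q +
      (1.104 * Real.log T ^ 2 + 0.173 * Real.log T * Real.log (Real.log T) + 0.51 * Real.log T) := by
  have hxT : x ≤ T := hxhi.trans (by linarith)
  have hlx1 : 1 < Real.log x := by
    rw [← Real.exp_lt_exp, Real.exp_log hx0]; exact hxe
  have hlx : Real.log x ≤ Real.log (T / 2) := Real.log_le_log hx0 hxhi
  have hlxT : Real.log x ≤ Real.log T := Real.log_le_log hx0 hxT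
  have hllx : Real.log (Real.log x) ≤ Real.log (Real.log T) := Real.log_le_log (by linarith) hlxT
  have hllx0 : 0 < Real.log (Real.log x) := Real.log_pos hlx1
  have hTe : 0 ≤ T ^ e := by positivity
  rw [hpow]
  have h1 : 10395.2 * (T ^ e * q) * Real.log x ≤ 10395.2 * T ^ e * Real.log (T / 2) * q := by
    have h0 : (0 : ℝ) ≤ 10395.2 * (T ^ e * q) := by positivity
    have := mul_le_mul_of_nonneg_left hlx h0
    linarith [show 10395.2 * (T ^ e * q) * Real.log (T / 2) =
      10395.2 * T ^ e * Real.log (T / 2) * q by ring]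
  have h2 : 1.104 * Real.log x ^ 2 ≤ 1.104 * Real.log T ^ 2 := by
    have := pow_le_pow_left₀ (by linarith : 0 ≤ Real.log x) hlxT 2
    linarith
  have h3 : 0.173 * Real.log x * Real.log (Real.log x) ≤ 0.173 * Real.log T * Real.log (Real.log T) := by
    have := mul_le_mul hlxT hllx hllx0.le hL0.le
    linarith
  have h4 : 0.51 * Real.log x ≤ 0.51 * Real.log T := by linarith
  linarith

end Simonic2020Dyadic

namespace Simonic2020_thm1

open Simonic2020Dyadic in
/-- **The dyadic corollary from Theorem 1** (Simonič 2020, the display after Theorem 1 —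
"an immediate corollary"): under `Simonic2020_thm1` and the tree's numerical-RH fact
`platt_trudgian_numerical_rh` (all zeros with `0 < γ ≤ 3·10¹²` are on the line, in particular up to
`2H₀`), for `σ ∈ [½, 0.831]`, `σ' > σ` and `T ≥ 2H₀`,
`N(σ', T) ≤ 10395.21/(2^e − 1) · T^e · log(T/2)`, `e = 1 − ¼(σ − ½)` — i.e. the named fact
`Simonic2020_thm1_dyadic`. [cite: Simonic2020, §1 (display after Thm. 1)] -/
theorem dyadic (h : Simonic2020_thm1) (hPT : platt_trudgian_numerical_rh) : Simonic2020_thm1_dyadic := by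
  intro σ σ' T hσ hσ1 hσσ' hT
  have hH : Simonic2020.H₀ = 30610046000 := rfl
  have hH0 : (0 : ℝ) < Simonic2020.H₀ := by rw [hH]; norm_num
  have hT0 : 0 < T := by linarith
  have hT1 : (1 : ℝ) ≤ T := by rw [hH] at hT; linarith
  set e := Simonic2020.selbergExponent σ with hedef
  have he1 : e ≤ 1 := by rw [hedef, Simonic2020.selbergExponent]; linarith
  have he0 : 0.917 ≤ e := by rw [hedef, Simonic2020.selbergExponent]; norm_num at hσ1 ⊢; linarith
  -- choose K with 2^K ≤ T/H₀ < 2^{K+1}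
  obtain ⟨K, hK1, hK2⟩ := exists_nat_pow_near (x := T / Simonic2020.H₀) (y := (2 : ℝ))
    (by rw [le_div_iff₀ hH0]; linarith) (by norm_num)
  have h2K : (0 : ℝ) < 2 ^ K := by positivity
  have hKlo : Simonic2020.H₀ ≤ T / 2 ^ K := by
    rw [le_div_iff₀ h2K]; rw [le_div_iff₀ hH0] at hK1; linarith
  have hKhi : T / 2 ^ K < 2 * Simonic2020.H₀ := by
    rw [div_lt_iff₀ h2K]; rw [div_lt_iff₀ hH0, pow_succ] at hK2; linarith
  -- N(σ', T/2^K) = 0 by numerical RH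
  have hzero : zetaZeroCountRe σ' (T / 2 ^ K) = 0 :=
    zetaZeroCountRe_eq_zero_of_numerical_rh hPT (by linarith) (by rw [hH] at hKhi; linarith)
  have hiter := iterate h hσ hσ1 hσσ' K T hKlo
  rw [hzero, Nat.cast_zero, zero_add] at hiter
  -- K ≤ log T/log 2 (from 2^K ≤ T/H₀ ≤ T)
  have hlog2 := Real.log_two_gt_d9
  have hKle : (K : ℝ) ≤ Real.log T / Real.log 2 := by
    rw [le_div_iff₀ (by linarith)]
    have h1 : (2 : ℝ) ^ K ≤ T := by
      refine hK1.trans (div_le_self hT0.le ?_)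
      rw [hH]; norm_num
    have h2 := Real.log_le_log h2K h1
    rwa [Real.log_pow] at h2
  -- bound each summand: f(T/2^{j+1}) ≤ a T^e r^{j+1} log(T/2) + g(T), r = 2^{-e}
  set r : ℝ := ((2 : ℝ) ^ e)⁻¹ with hrdef
  have h2e : (1 : ℝ) < (2 : ℝ) ^ e := Real.one_lt_rpow (by norm_num) (by linarith)
  have h2e2 : (2 : ℝ) ^ e ≤ 2 := by
    have := Real.rpow_le_rpow_of_exponent_le (by norm_num : (1 : ℝ) ≤ 2) he1
    rwa [Real.rpow_one] at this
  have hr0 : 0 < r := by rw [hrdef]; positivity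
  have hr1 : r < 1 := by rw [hrdef]; exact inv_lt_one_of_one_lt₀ h2e
  have hL : (24 : ℝ) ≤ Real.log T := by
    -- as in `lower_order_le`
    rw [← Real.log_exp 24]
    refine Real.log_le_log (Real.exp_pos _) ?_
    have e24 : Real.exp 24 = Real.exp 1 ^ 24 := by rw [← Real.exp_nat_mul]; norm_num
    rw [e24]
    calc Real.exp 1 ^ 24 ≤ (2.72 : ℝ) ^ 24 :=
          pow_le_pow_left₀ (Real.exp_pos 1).le (by linarith [Real.exp_one_lt_d9]) 24
      _ ≤ T := by rw [hH] at hT; norm_num; linarith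
  have hL0 : 0 < Real.log T := by linarith
  have hlogT2 : 0 < Real.log (T / 2) := by
    rw [Real.log_div hT0.ne' (by norm_num)]; linarith [Real.log_two_lt_d9]
  have hsummand : ∀ j ∈ range K, (10395.2 * (T / 2 ^ (j + 1)) ^ e * Real.log (T / 2 ^ (j + 1)) + 1.104 * Real.log (T / 2 ^ (j + 1)) ^ 2
        + 0.173 * Real.log (T / 2 ^ (j + 1)) * Real.log (Real.log (T / 2 ^ (j + 1))) + 0.51 * Real.log (T / 2 ^ (j + 1))) ≤
      10395.2 * T ^ e * Real.log (T / 2) * r ^ (j + 1) +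
        (1.104 * Real.log T ^ 2 + 0.173 * Real.log T * Real.log (Real.log T) + 0.51 * Real.log T) := by
    intro j hj
    have hj' : j + 1 ≤ K := by rw [Finset.mem_range] at hj; omega
    have hx0 : 0 < T / 2 ^ (j + 1) := by positivity
    have hxlo : Simonic2020.H₀ ≤ T / 2 ^ (j + 1) := by
      refine hKlo.trans ?_
      exact div_le_div_of_nonneg_left hT0.le (by positivity)
        (pow_le_pow_right₀ (by norm_num) hj')
    have hxhi : T / 2 ^ (j + 1) ≤ T / 2 := by
      refine div_le_div_of_nonneg_left hT0.le (by norm_num) ?_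
      calc (2 : ℝ) = 2 ^ 1 := by norm_num
        _ ≤ 2 ^ (j + 1) := pow_le_pow_right₀ (by norm_num) (by omega)
    have hxe : Real.exp 1 < T / 2 ^ (j + 1) := by
      rw [hH] at hxlo; linarith [Real.exp_one_lt_d9]
    have hpow : (T / 2 ^ (j + 1)) ^ e = T ^ e * r ^ (j + 1) := by
      rw [Real.div_rpow hT0.le (by positivity), Simonic2020Dyadic.two_pow_rpow, hrdef, inv_pow,
        div_eq_mul_inv]
    exact Simonic2020Dyadic.summand_le hT0 hL0 hx0 hxe hxhi (by positivity) hpow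
  have hsum0 := Finset.sum_le_sum hsummand
  have hrhs : ∑ j ∈ range K, (10395.2 * T ^ e * Real.log (T / 2) * r ^ (j + 1) +
      (1.104 * Real.log T ^ 2 + 0.173 * Real.log T * Real.log (Real.log T) + 0.51 * Real.log T)) =
      10395.2 * T ^ e * Real.log (T / 2) * ∑ j ∈ range K, r ^ (j + 1) +
        (K : ℝ) * (1.104 * Real.log T ^ 2 + 0.173 * Real.log T * Real.log (Real.log T)
          + 0.51 * Real.log T) := by
    rw [Finset.sum_add_distrib, Finset.sum_const, Finset.card_range, nsmul_eq_mul,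
      ← Finset.mul_sum]
  have hsum := hsum0.trans hrhs.le
  have hgeom := geom_bound hr0 hr1 K
  -- r/(1−r) = 1/(2^e − 1)
  have hr_eq : r / (1 - r) = 1 / ((2 : ℝ) ^ e - 1) := by
    rw [hrdef]
    have hne : (2 : ℝ) ^ e - 1 ≠ 0 := by linarith
    have hne2 : (2 : ℝ) ^ e ≠ 0 := by positivity
    rw [div_eq_div_iff (by
      intro h0
      have : ((2 : ℝ) ^ e)⁻¹ = 1 := by linarith
      rw [inv_eq_one] at this
      exact absurd this (by linarith)) hne]
    field_simp
  rw [hr_eq] at hgeom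
  have hmain : 10395.2 * T ^ e * Real.log (T / 2) * ∑ j ∈ range K, r ^ (j + 1) ≤
      10395.2 * T ^ e * Real.log (T / 2) * (1 / ((2 : ℝ) ^ e - 1)) :=
    mul_le_mul_of_nonneg_left hgeom (by positivity)
  -- lower-order part
  have hlow : (K : ℝ) *
      (1.104 * Real.log T ^ 2 + 0.173 * Real.log T * Real.log (Real.log T) + 0.51 * Real.log T) ≤
      0.01 * T ^ e * Real.log (T / 2) := by
    have hg0 : 0 ≤ 1.104 * Real.log T ^ 2 + 0.173 * Real.log T * Real.log (Real.log T)
        + 0.51 * Real.log T := by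
      have : 0 ≤ Real.log (Real.log T) := Real.log_nonneg (by linarith)
      positivity
    exact (mul_le_mul_of_nonneg_right hKle hg0).trans (lower_order_le hT he0)
  -- 0.01 T^e log(T/2) ≤ 0.01 T^e log(T/2)/(2^e − 1) since 2^e − 1 ≤ 1
  have hlow' : 0.01 * T ^ e * Real.log (T / 2) ≤
      0.01 * T ^ e * Real.log (T / 2) * (1 / ((2 : ℝ) ^ e - 1)) := by
    have hpos : 0 < 0.01 * T ^ e * Real.log (T / 2) := by positivity
    have : (1 : ℝ) ≤ 1 / ((2 : ℝ) ^ e - 1) := by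
      rw [le_div_iff₀ (by linarith)]; linarith
    nlinarith
  calc (zetaZeroCountRe σ' T : ℝ) ≤ ∑ j ∈ range K, (10395.2 * (T / 2 ^ (j + 1)) ^ e * Real.log (T / 2 ^ (j + 1)) + 1.104 * Real.log (T / 2 ^ (j + 1)) ^ 2
        + 0.173 * Real.log (T / 2 ^ (j + 1)) * Real.log (Real.log (T / 2 ^ (j + 1))) + 0.51 * Real.log (T / 2 ^ (j + 1))) := hiter
    _ ≤ 10395.2 * T ^ e * Real.log (T / 2) * ∑ j ∈ range K, r ^ (j + 1) +
          (K : ℝ) * (1.104 * Real.log T ^ 2 + 0.173 * Real.log T * Real.log (Real.log T)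
            + 0.51 * Real.log T) := hsum
    _ ≤ 10395.2 * T ^ e * Real.log (T / 2) * (1 / ((2 : ℝ) ^ e - 1)) +
          0.01 * T ^ e * Real.log (T / 2) * (1 / ((2 : ℝ) ^ e - 1)) := by linarith
    _ = 10395.21 / ((2 : ℝ) ^ e - 1) * T ^ e * Real.log (T / 2) := by
          have hne : (2 : ℝ) ^ e - 1 ≠ 0 := by linarith
          field_simp
          ring

end Simonic2020_thm1

/-- `Simonic2020_thm1_dyadic` follows from `Simonic2020_thm1` and the numerical verification of RH
(top-level restatement of `Simonic2020_thm1.dyadic`). [cite: Simonic2020, §1 (display after Thm. 1)] -/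
theorem Simonic2020_thm1_dyadic_of_thm1 (h : Simonic2020_thm1) (hPT : platt_trudgian_numerical_rh) :
    Simonic2020_thm1_dyadic :=
  Simonic2020_thm1.dyadic h hPT

end Literature.NumberTheory.LFunctions

end
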